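import Summits.CriticalPhenomena.PercolationContinuityZ3.Theorems.PercNearOneGluingNoHeavyLowerTailTwoCopyLadderCubic

/-!
# The contraction-closed GOOD side class for the q³ polarization (FINDING-25 §3d–§3e)

Companion to `…TwoCopyLadderCubic` (crux `stmt-CriticalPhenomena-4575`, new-inequality factory `prim-ineq-gen-1`, gen 18; memo
`run/shared/lean/prim/prim-ineq-gen-1/FINDING-25-ladder-q3-polarization.md` §3d–§3e, proof memo `THEOREM-L3.md`).

Every 3-terminal side of a CONTRACTION-MINOR of a ladder is generated from the one-vertex side `triv` by the four moves `rungStep`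
(edge between the current terminals), `pendU` / `pendW` (pendant edge at a terminal, the new vertex becoming that terminal; note
`colStep = pendU ∘ pendW ∘ rungStep`) and `mergeUW` (identify the terminals = contract a rung).  This file proves that the predicate
`Good` (type sums ≥ 0, side form `κ ≥ 0`, and the degeneracy clause `p + m = 0 → c = 0 ∨ s = 0`) holds for `triv` and is preserved by
all four moves — via the exact identities `κ(rungStep) = (1+t)κ`, `κ(mergeUW) = 0`, `(p+m)κ(pendU_ρ) = (ρ³(p+m) + cρ²)κ + c²p²ρ²`,
`(p+m)κ(pendW_ρ) = (ρ³(p+m) + cρ²)κ + c²m²ρ²` — and that the polarization theorem holds for any two good sides with no positivity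
provisos (`Bform_nonneg_of_good`).  With the universality lemma and the case classification of the memo (validated exactly on 1,385
minor instances) this is the algebra behind THEOREM L3*** (lowest-grade edge shadow for every edge of every contraction-minor of every
ladder) and COROLLARY U∞ (the lowest grade of `H_{L_r}([a~v], ↑S)` is ≥ 0 for every edge set `S` of every ladder).  Also recorded:
`σ(pendU) = ρ²σ`, `σ(mergeUW) = 0`.  Not formalised: the graph-theoretic identification of the moves with minors.  (This work, 2026-08-21.)
-/

namespace Summit.CriticalPhenomena.PercolationContinuityZ3.Theorems

namespace TwoCopyLadderCubic

variable {R : Type*} [CommRing R] [LinearOrder R] [IsStrictOrderedRing R]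


/-- Pendant edge of weight `ρ` at the terminal `u` (new terminal `u'`): `c ↦ ρc`, `p ↦ ρp`, `m ↦ ρm + c`, `d ↦ ρd`, `s ↦ ρs + p + d`. [this work] -/
def pendU (ρ : R) (L : SVec R) : SVec R :=
  { c := ρ * L.c, p := ρ * L.p, m := ρ * L.m + L.c, d := ρ * L.d, s := ρ * L.s + L.p + L.d }

/-- Identify the two terminals `u, w` (contract a rung): `c ↦ c+p+m`, `d ↦ d+s`, `p, m, s ↦ 0`. [this work] -/
def mergeUW (L : SVec R) : SVec R := { c := L.c + L.p + L.m, p := 0, m := 0, d := L.d + L.s, s := 0 }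

/-- The one-vertex side (apex and both terminals coincide): `c = 1`, all else `0`. [this work] -/
def triv : SVec R := { c := 1, p := 0, m := 0, d := 0, s := 0 }

omit [LinearOrder R] [IsStrictOrderedRing R] in
/-- `κ` under a pendant move at `u`: `(p+m)κ' = (ρ³(p+m) + cρ²)κ + c²p²ρ²`. [this work] -/
theorem kappa_pendU (ρ : R) (L : SVec R) :
    (L.p + L.m) * kappa (pendU ρ L) = (ρ ^ 3 * (L.p + L.m) + L.c * ρ ^ 2) * kappa L + L.c ^ 2 * L.p ^ 2 * ρ ^ 2 := by
  unfold kappa pendU; ring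

omit [LinearOrder R] [IsStrictOrderedRing R] in
/-- `κ` under a pendant move at `w`: `(p+m)κ' = (ρ³(p+m) + cρ²)κ + c²m²ρ²`. [this work] -/
theorem kappa_pendW (ρ : R) (L : SVec R) :
    (L.p + L.m) * kappa (pendW ρ L) = (ρ ^ 3 * (L.p + L.m) + L.c * ρ ^ 2) * kappa L + L.c ^ 2 * L.m ^ 2 * ρ ^ 2 := by
  unfold kappa pendW; ring

omit [LinearOrder R] [IsStrictOrderedRing R] in
/-- `κ` under a terminal rung: `κ ↦ (1+t)κ`. [this work] -/
theorem kappa_rungStep' (t : R) (L : SVec R) : kappa (rungStep t L) = (1 + t) * kappa L := by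
  unfold kappa rungStep; ring

omit [LinearOrder R] [IsStrictOrderedRing R] in
/-- `κ` vanishes after a merge. [this work] -/
theorem kappa_mergeUW (L : SVec R) : kappa (mergeUW L) = 0 := by
  unfold kappa mergeUW; ring

/-- A GOOD side: nonnegative type sums, `κ ≥ 0`, and the degeneracy clause (if `p = m = 0` then the apex is dead or the terminals
are merged). [this work] -/
structure Good (L : SVec R) : Prop where
  /-- entries nonnegative -/
  nn : L.Nonneg
  /-- the side form -/
  hk : 0 ≤ kappa L
  /-- degeneracy clause -/
  deg : L.p + L.m = 0 → L.c = 0 ∨ L.s = 0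

/-- The one-vertex side is good. [this work] -/
theorem good_triv : Good (triv : SVec R) := by
  refine ⟨⟨zero_le_one, le_rfl, le_rfl, le_rfl, le_rfl⟩, ?_, fun _ => Or.inr rfl⟩
  show 0 ≤ kappa triv
  unfold kappa triv; norm_num

/-- A terminal rung keeps a side good. [this work] -/
theorem good_rungStep {t : R} (ht : 0 ≤ t) {L : SVec R} (h : Good L) : Good (rungStep t L) := by
  obtain ⟨⟨hc, hp, hm, hd, hs⟩, hk, deg⟩ := h
  refine ⟨⟨?_, hp, hm, ?_, hs⟩, ?_, ?_⟩
  · show 0 ≤ L.c + t * (L.c + L.p + L.m); positivity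
  · show 0 ≤ L.d + t * (L.d + L.s); positivity
  · rw [kappa_rungStep']; exact mul_nonneg (by linarith) hk
  · intro h0
    have hp0 : L.p = 0 := by change L.p + L.m = 0 at h0; linarith
    have hm0 : L.m = 0 := by change L.p + L.m = 0 at h0; linarith
    rcases deg (by rw [hp0, hm0]; ring) with hc0 | hs0
    · left; show L.c + t * (L.c + L.p + L.m) = 0; rw [hc0, hp0, hm0]; ring
    · right; exact hs0

/-- A merge keeps a side good. [this work] -/
theorem good_mergeUW {L : SVec R} (h : Good L) : Good (mergeUW L) := by
  obtain ⟨⟨hc, hp, hm, hd, hs⟩, _, _⟩ := h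
  refine ⟨⟨?_, le_rfl, le_rfl, ?_, le_rfl⟩, ?_, fun _ => Or.inr rfl⟩
  · show 0 ≤ L.c + L.p + L.m; positivity
  · show 0 ≤ L.d + L.s; positivity
  · rw [kappa_mergeUW]

/-- A pendant move at `u` keeps a side good. [this work] -/
theorem good_pendU {ρ : R} (hρ : 0 ≤ ρ) {L : SVec R} (h : Good L) : Good (pendU ρ L) := by
  obtain ⟨⟨hc, hp, hm, hd, hs⟩, hk, deg⟩ := h
  refine ⟨⟨?_, ?_, ?_, ?_, ?_⟩, ?_, ?_⟩
  · show 0 ≤ ρ * L.c; positivity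
  · show 0 ≤ ρ * L.p; positivity
  · show 0 ≤ ρ * L.m + L.c; positivity
  · show 0 ≤ ρ * L.d; positivity
  · show 0 ≤ ρ * L.s + L.p + L.d; positivity
  · rcases lt_or_eq_of_le (add_nonneg hp hm : 0 ≤ L.p + L.m) with hpos | h0
    · have key := kappa_pendU ρ L
      have hrhs : 0 ≤ (L.p + L.m) * kappa (pendU ρ L) := by
        rw [key]
        have h1 : 0 ≤ (ρ ^ 3 * (L.p + L.m) + L.c * ρ ^ 2) * kappa L := mul_nonneg (by positivity) hk
        have h2 : 0 ≤ L.c ^ 2 * L.p ^ 2 * ρ ^ 2 := by positivity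
        linarith
      exact (mul_nonneg_iff_of_pos_left hpos).mp hrhs
    · have hp0 : L.p = 0 := by linarith
      have hm0 : L.m = 0 := by linarith
      rcases deg h0.symm with hc0 | hs0
      · have : kappa (pendU ρ L) = 0 := by unfold kappa pendU; rw [hp0, hm0, hc0]; ring
        rw [this]
      · have : kappa (pendU ρ L) = 0 := by unfold kappa pendU; rw [hp0, hm0, hs0]; ring
        rw [this]
  · intro h0
    change ρ * L.p + (ρ * L.m + L.c) = 0 at h0
    have h1 : 0 ≤ ρ * L.p := by positivity
    have h2 : 0 ≤ ρ * L.m := by positivity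
    have hc0 : L.c = 0 := le_antisymm (by linarith) hc
    left; show ρ * L.c = 0; rw [hc0]; ring

/-- A pendant move at `w` keeps a side good. [this work] -/
theorem good_pendW {ρ : R} (hρ : 0 ≤ ρ) {L : SVec R} (h : Good L) : Good (pendW ρ L) := by
  obtain ⟨⟨hc, hp, hm, hd, hs⟩, hk, deg⟩ := h
  refine ⟨⟨?_, ?_, ?_, ?_, ?_⟩, ?_, ?_⟩
  · show 0 ≤ ρ * L.c; positivity
  · show 0 ≤ ρ * L.p + L.c; positivity
  · show 0 ≤ ρ * L.m; positivity
  · show 0 ≤ ρ * L.d; positivity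
  · show 0 ≤ ρ * L.s + L.m + L.d; positivity
  · rcases lt_or_eq_of_le (add_nonneg hp hm : 0 ≤ L.p + L.m) with hpos | h0
    · have key := kappa_pendW ρ L
      have hrhs : 0 ≤ (L.p + L.m) * kappa (pendW ρ L) := by
        rw [key]
        have h1 : 0 ≤ (ρ ^ 3 * (L.p + L.m) + L.c * ρ ^ 2) * kappa L := mul_nonneg (by positivity) hk
        have h2 : 0 ≤ L.c ^ 2 * L.m ^ 2 * ρ ^ 2 := by positivity
        linarith
      exact (mul_nonneg_iff_of_pos_left hpos).mp hrhs
    · have hp0 : L.p = 0 := by linarith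
      have hm0 : L.m = 0 := by linarith
      rcases deg h0.symm with hc0 | hs0
      · have : kappa (pendW ρ L) = 0 := by unfold kappa pendW; rw [hp0, hm0, hc0]; ring
        rw [this]
      · have : kappa (pendW ρ L) = 0 := by unfold kappa pendW; rw [hp0, hm0, hs0]; ring
        rw [this]
  · intro h0
    change ρ * L.p + L.c + ρ * L.m = 0 at h0
    have h1 : 0 ≤ ρ * L.p := by positivity
    have h2 : 0 ≤ ρ * L.m := by positivity
    have hc0 : L.c = 0 := le_antisymm (by linarith) hc
    left; show ρ * L.c = 0; rw [hc0]; ring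

/-- THEOREM S2 for good sides (no positivity side conditions): `0 ≤ Bform L K`. [this work] -/
theorem Bform_nonneg_of_good {L K : SVec R} (hL : Good L) (hK : Good K) : 0 ≤ Bform L K := by
  obtain ⟨hLn, hkL, degL⟩ := hL
  obtain ⟨hKn, hkK, degK⟩ := hK
  obtain ⟨hc, hp, hm, hd, hs⟩ := hLn
  obtain ⟨hC, hP, hM, hD, hS⟩ := hKn
  rcases lt_or_eq_of_le (add_nonneg hp hm : 0 ≤ L.p + L.m) with hLpos | hL0
  · rcases lt_or_eq_of_le (add_nonneg hP hM : 0 ≤ K.p + K.m) with hKpos | hK0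
    · exact Bform_nonneg L K ⟨hc, hp, hm, hd, hs⟩ ⟨hC, hP, hM, hD, hS⟩ hLpos hKpos hkL hkK
    · have hP0 : K.p = 0 := by linarith
      have hM0 : K.m = 0 := by linarith
      rcases degK hK0.symm with hC0 | hS0
      · have : Bform L K = 0 := by unfold Bform; rw [hP0, hM0, hC0]; ring
        rw [this]
      · have : Bform L K = 0 := by unfold Bform; rw [hP0, hM0, hS0]; ring
        rw [this]
  · have hp0 : L.p = 0 := by linarith
    have hm0 : L.m = 0 := by linarith
    rcases degL hL0.symm with hc0 | hs0
    · have : Bform L K = 0 := by unfold Bform; rw [hp0, hm0, hc0]; ring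
      rw [this]
    · have : Bform L K = 0 := by unfold Bform; rw [hp0, hm0, hs0]; ring
      rw [this]

omit [LinearOrder R] [IsStrictOrderedRing R] in
/-- `σ` under a pendant move at `u`: exactly `ρ²σ`. [this work] -/
theorem sigma_pendU (ρ : R) (L : SVec R) : sigma (pendU ρ L) = ρ ^ 2 * sigma L := by
  unfold sigma pendU; ring

omit [LinearOrder R] [IsStrictOrderedRing R] in
/-- `σ` vanishes after a merge. [this work] -/
theorem sigma_mergeUW (L : SVec R) : sigma (mergeUW L) = 0 := by
  unfold sigma mergeUW; ring

end TwoCopyLadderCubic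

end Summit.CriticalPhenomena.PercolationContinuityZ3.Theorems
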